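import Mathlib
import Summits.Ventures.PercRepro2.Defs
import Summits.Ventures.PercRepro2.Graph
import Summits.Ventures.PercRepro2.Harris
import Summits.Ventures.PercRepro2.PartitionThreeComplement
import Summits.Ventures.PercRepro2.HarrisComplement
import Summits.Ventures.PercRepro2.OneColourSwitch
import Summits.Ventures.PercRepro2.CutVertexPaths
import Summits.Ventures.PercRepro2.CutVertexM9

/-!
# The cut-vertex product formula for arbitrary increasing side-local events, and the
`(G1)` generalisation of `m9` for mark sets (blind cell PercRepro2, p3 g16, 2026-08-27;
`proofs/P3-CPNC.md` §13k)

The proof of `CutVertexM9.card_mul_m9SignSum_eq` used only that the four events involved are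
INCREASING and SIDE-LOCAL.  Abstractly: for events `A`, `RL` reading only the edges of side `true`
and `B`, `RR` reading only the edges of side `false`, all increasing, with
`σ_A(ω) = 1[ω ∈ A] − 1[ω̄ ∈ A]` and `Sep = ¬(RL ∧ RR) ∧ ¬(RL̄ ∧ RR̄)`,
`#Config · Σ_Sep σ_A σ_B = −2 · (Σ 1[RL] σ_A) · (Σ 1[RR] σ_B)` and both factors are `≥ 0`
(`card_mul_sepSum_eq`, `sepSum_nonpos`).  Instances: `m9` (P3-CPNC §13b) and the cell's `(G1)`
(P3-M9 §5): for mark SETS `P`, `T` separated by a cut vertex `v`,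
`Σ_{P ≁ T in both colours} (1[P in one Y-block] − 1[P in one W-block]) ·
  (1[T in one Y-block] − 1[T in one W-block]) ≤ 0` (`g1Sum_nonpos_of_cutVertex`).
Own work; std axioms.
-/

namespace Summit.Ventures.PercRepro2

namespace CutVertexM9

open Finset Classical

variable {V : Type*} {E : Type*}

/-! ## The abstract product formula -/

section Abstract

variable [Fintype E] [DecidableEq E]

/-- The colour preference of an event: `1[ω ∈ A] − 1[ω̄ ∈ A]`. -/
noncomputable def sigmaOf (A : Set (Config E)) (ω : Config E) : ℤ :=
  (if ω ∈ A then 1 else 0) - (if OneColourSwitch.compl ω ∈ A then 1 else 0)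

/-- The indicator of an event. -/
noncomputable def indOf (A : Set (Config E)) (ω : Config E) : ℤ := if ω ∈ A then 1 else 0

/-- The two-colour separation built from two «reach» events: neither colour has both. -/
def sepOf (RL RR : Set (Config E)) (ω : Config E) : Prop :=
  ¬ (ω ∈ RL ∧ ω ∈ RR) ∧
    ¬ (OneColourSwitch.compl ω ∈ RL ∧ OneColourSwitch.compl ω ∈ RR)

/-- The separated sign sum `Σ_Sep σ_A σ_B`. -/
noncomputable def sepSum (A B RL RR : Set (Config E)) : ℤ :=
  ∑ ω : Config E, if sepOf RL RR ω then sigmaOf A ω * sigmaOf B ω else 0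

/-- An event reads only the edges of one side. -/
def SideLocal (side : E → Bool) (b : Bool) (A : Set (Config E)) : Prop :=
  ∀ ω ω' : Config E, (∀ e, side e = b → ω e = ω' e) → (ω ∈ A ↔ ω' ∈ A)

omit [Fintype E] [DecidableEq E] in
/-- The pointwise expansion of the separated kernel. -/
lemma kernel_eq_abstract (A B RL RR : Set (Config E)) (ω : Config E) :
    (if sepOf RL RR ω then sigmaOf A ω * sigmaOf B ω else 0) =
      (1 - indOf RL ω * indOf RR ω) *
        (1 - indOf RL (OneColourSwitch.compl ω) * indOf RR (OneColourSwitch.compl ω)) *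
        (sigmaOf A ω * sigmaOf B ω) := by
  unfold sepOf indOf
  by_cases h1 : ω ∈ RL <;> by_cases h2 : ω ∈ RR <;>
    by_cases h3 : OneColourSwitch.compl ω ∈ RL <;> by_cases h4 : OneColourSwitch.compl ω ∈ RR <;>
    simp [h1, h2, h3, h4]

omit [Fintype E] [DecidableEq E] in
/-- The colour flip negates `σ_A`. -/
lemma sigmaOf_compl (A : Set (Config E)) (ω : Config E) :
    sigmaOf A (OneColourSwitch.compl ω) = - sigmaOf A ω := by
  simp only [sigmaOf, OneColourSwitch.compl_compl]
  ring

/-- `Σ σ_A = 0`. -/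
lemma sum_sigmaOf_eq_zero (A : Set (Config E)) : ∑ ω : Config E, sigmaOf A ω = 0 := by
  have h := sum_compl (fun ω : Config E => sigmaOf A ω)
  simp only [sigmaOf_compl, Finset.sum_neg_distrib] at h
  linarith

/-- `Σ 1[RL̄] σ_A = −Σ 1[RL] σ_A`. -/
lemma sum_indOf_compl_mul_sigmaOf (A RL : Set (Config E)) :
    ∑ ω : Config E, indOf RL (OneColourSwitch.compl ω) * sigmaOf A ω =
      - ∑ ω : Config E, indOf RL ω * sigmaOf A ω := by
  have h := sum_compl (fun ω : Config E => indOf RL (OneColourSwitch.compl ω) * sigmaOf A ω)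
  simp only [OneColourSwitch.compl_compl, sigmaOf_compl, mul_neg, Finset.sum_neg_distrib] at h
  linarith

/-- `Σ 1[RL] 1[RL̄] σ_A = 0`. -/
lemma sum_indOf_mul_indOf_compl_mul_sigmaOf (A RL : Set (Config E)) :
    ∑ ω : Config E, indOf RL ω * indOf RL (OneColourSwitch.compl ω) * sigmaOf A ω = 0 := by
  have h := sum_compl (fun ω : Config E =>
    indOf RL ω * indOf RL (OneColourSwitch.compl ω) * sigmaOf A ω)
  simp only [OneColourSwitch.compl_compl, sigmaOf_compl, mul_neg, Finset.sum_neg_distrib] at h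
  have h2 : ∑ ω : Config E, indOf RL (OneColourSwitch.compl ω) * indOf RL ω * sigmaOf A ω =
      ∑ ω : Config E, indOf RL ω * indOf RL (OneColourSwitch.compl ω) * sigmaOf A ω :=
    Finset.sum_congr rfl (fun ω _ => by ring)
  linarith

omit [Fintype E] [DecidableEq E] in
/-- A side-local event's `σ` and indicator are side-local. -/
lemma sigmaOf_congr {side : E → Bool} {b : Bool} {A : Set (Config E)} (hA : SideLocal side b A)
    {ω ω' : Config E} (hag : ∀ e, side e = b → ω e = ω' e) : sigmaOf A ω = sigmaOf A ω' := by
  unfold sigmaOf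
  rw [if_congr (hA ω ω' hag) rfl rfl,
    if_congr (hA _ _ (compl_agree hag)) rfl rfl]

omit [Fintype E] [DecidableEq E] in
/-- The indicator of a side-local event is side-local. -/
lemma indOf_congr {side : E → Bool} {b : Bool} {A : Set (Config E)} (hA : SideLocal side b A)
    {ω ω' : Config E} (hag : ∀ e, side e = b → ω e = ω' e) : indOf A ω = indOf A ω' := by
  unfold indOf
  rw [if_congr (hA ω ω' hag) rfl rfl]

/-- **`Σ 1[RL] σ_A ≥ 0` for increasing `A`, `RL`** (Harris with the complement). -/
theorem indOf_mul_sigmaOf_sum_nonneg {A RL : Set (Config E)} (hA : IsUpperSet A)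
    (hRL : IsUpperSet RL) : 0 ≤ ∑ ω : Config E, indOf RL ω * sigmaOf A ω := by
  have key := card_filter_le_of_isUpperSet hA hRL
    (fun ω => ω ∈ A ∧ ω ∈ RL) (fun ω => ω ∈ RL ∧ OneColourSwitch.compl ω ∈ A)
    (fun ω => Iff.rfl) (fun ω => Iff.rfl)
  have hsum : ∑ ω : Config E, indOf RL ω * sigmaOf A ω =
      ∑ ω : Config E, ((if ω ∈ A ∧ ω ∈ RL then (1 : ℤ) else 0) -
        (if ω ∈ RL ∧ OneColourSwitch.compl ω ∈ A then (1 : ℤ) else 0)) := by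
    refine Finset.sum_congr rfl fun ω _ => ?_
    unfold indOf sigmaOf
    by_cases h1 : ω ∈ RL <;> by_cases h2 : ω ∈ A <;>
      by_cases h3 : OneColourSwitch.compl ω ∈ A <;> simp [h1, h2, h3]
  rw [hsum, Finset.sum_sub_distrib, Finset.sum_boole, Finset.sum_boole]
  have key' : ((univ.filter (fun ω : Config E =>
      ω ∈ RL ∧ OneColourSwitch.compl ω ∈ A)).card : ℤ) ≤
      ((univ.filter (fun ω : Config E => ω ∈ A ∧ ω ∈ RL)).card : ℤ) := by exact_mod_cast key
  linarith

/-- **The abstract product formula**: for side-local `A, RL` (side `true`) and `B, RR` (side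
`false`), `#Config · Σ_Sep σ_A σ_B = −2 · (Σ 1[RL] σ_A) · (Σ 1[RR] σ_B)`. -/
theorem card_mul_sepSum_eq (side : E → Bool) {A B RL RR : Set (Config E)}
    (hA : SideLocal side true A) (hRL : SideLocal side true RL)
    (hB : SideLocal side false B) (hRR : SideLocal side false RR) :
    (Fintype.card (Config E) : ℤ) * sepSum A B RL RR =
      -2 * (∑ ω : Config E, indOf RL ω * sigmaOf A ω) *
        (∑ ω : Config E, indOf RR ω * sigmaOf B ω) := by
  have hker : ∀ ω : Config E,
      (if sepOf RL RR ω then sigmaOf A ω * sigmaOf B ω else 0) =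
      sigmaOf A ω * sigmaOf B ω
      - (indOf RL ω * sigmaOf A ω) * (indOf RR ω * sigmaOf B ω)
      - (indOf RL (OneColourSwitch.compl ω) * sigmaOf A ω) *
          (indOf RR (OneColourSwitch.compl ω) * sigmaOf B ω)
      + (indOf RL ω * indOf RL (OneColourSwitch.compl ω) * sigmaOf A ω) *
          (indOf RR ω * indOf RR (OneColourSwitch.compl ω) * sigmaOf B ω) := by
    intro ω
    rw [kernel_eq_abstract]
    ring
  have i1 : (∑ ω : Config E, sigmaOf A ω * sigmaOf B ω) * (Fintype.card (Config E) : ℤ) =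
      (∑ ω : Config E, sigmaOf A ω) * (∑ ω : Config E, sigmaOf B ω) :=
    sum_mul_mul_card side _ _ (fun ω ω' hag => sigmaOf_congr hA hag)
      (fun ω ω' hag => sigmaOf_congr hB hag)
  have i2 : (∑ ω : Config E, (indOf RL ω * sigmaOf A ω) * (indOf RR ω * sigmaOf B ω)) *
      (Fintype.card (Config E) : ℤ) =
      (∑ ω : Config E, indOf RL ω * sigmaOf A ω) * (∑ ω : Config E, indOf RR ω * sigmaOf B ω) :=
    sum_mul_mul_card side _ _
      (fun ω ω' hag => by rw [indOf_congr hRL hag, sigmaOf_congr hA hag])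
      (fun ω ω' hag => by rw [indOf_congr hRR hag, sigmaOf_congr hB hag])
  have i3 : (∑ ω : Config E, (indOf RL (OneColourSwitch.compl ω) * sigmaOf A ω) *
      (indOf RR (OneColourSwitch.compl ω) * sigmaOf B ω)) * (Fintype.card (Config E) : ℤ) =
      (∑ ω : Config E, indOf RL (OneColourSwitch.compl ω) * sigmaOf A ω) *
        (∑ ω : Config E, indOf RR (OneColourSwitch.compl ω) * sigmaOf B ω) :=
    sum_mul_mul_card side _ _
      (fun ω ω' hag => by rw [indOf_congr hRL (compl_agree hag), sigmaOf_congr hA hag])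
      (fun ω ω' hag => by rw [indOf_congr hRR (compl_agree hag), sigmaOf_congr hB hag])
  have i4 : (∑ ω : Config E,
      (indOf RL ω * indOf RL (OneColourSwitch.compl ω) * sigmaOf A ω) *
      (indOf RR ω * indOf RR (OneColourSwitch.compl ω) * sigmaOf B ω)) *
      (Fintype.card (Config E) : ℤ) =
      (∑ ω : Config E, indOf RL ω * indOf RL (OneColourSwitch.compl ω) * sigmaOf A ω) *
        (∑ ω : Config E, indOf RR ω * indOf RR (OneColourSwitch.compl ω) * sigmaOf B ω) :=
    sum_mul_mul_card side _ _
      (fun ω ω' hag => by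
        rw [indOf_congr hRL hag, indOf_congr hRL (compl_agree hag), sigmaOf_congr hA hag])
      (fun ω ω' hag => by
        rw [indOf_congr hRR hag, indOf_congr hRR (compl_agree hag), sigmaOf_congr hB hag])
  have f1 := sum_sigmaOf_eq_zero (E := E) A
  have f2 := sum_indOf_compl_mul_sigmaOf (E := E) A RL
  have f3 := sum_indOf_compl_mul_sigmaOf (E := E) B RR
  have f4 := sum_indOf_mul_indOf_compl_mul_sigmaOf (E := E) A RL
  rw [f1, zero_mul] at i1
  rw [f2, f3] at i3
  rw [f4, zero_mul] at i4
  unfold sepSum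
  simp only [hker, Finset.sum_add_distrib, Finset.sum_sub_distrib]
  linear_combination i1 - i2 - i3 + i4

/-- **The abstract cut-vertex theorem**: for increasing side-local events, `Σ_Sep σ_A σ_B ≤ 0`. -/
theorem sepSum_nonpos (side : E → Bool) {A B RL RR : Set (Config E)}
    (hA : SideLocal side true A) (hRL : SideLocal side true RL)
    (hB : SideLocal side false B) (hRR : SideLocal side false RR)
    (hAu : IsUpperSet A) (hRLu : IsUpperSet RL) (hBu : IsUpperSet B) (hRRu : IsUpperSet RR) :
    sepSum A B RL RR ≤ 0 := by
  have hN : (0 : ℤ) < Fintype.card (Config E) := by exact_mod_cast Fintype.card_pos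
  have key := card_mul_sepSum_eq side hA hRL hB hRR
  have hα := indOf_mul_sigmaOf_sum_nonneg hAu hRLu
  have hβ := indOf_mul_sigmaOf_sum_nonneg hBu hRRu
  have hprod : (Fintype.card (Config E) : ℤ) * sepSum A B RL RR ≤ 0 := by
    rw [key]
    nlinarith [mul_nonneg hα hβ]
  rcases le_or_gt (sepSum A B RL RR) 0 with hle | hlt
  · exact hle
  · exfalso
    have := mul_pos hN hlt
    linarith

end Abstract

/-! ## The `(G1)` instance: mark sets `P`, `T` at a cut vertex -/

section G1

variable {ends : E → Sym2 V} {side : E → Bool} {L : Set V} {v : V} {Rt : Set V}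

/-- `P` lies in one block: every two marks of `P` are joined. -/
def AllConn (ends : E → Sym2 V) (P : Set V) : Set (Config E) :=
  {ω | ∀ x ∈ P, ∀ y ∈ P, Conn ends ω x y}

/-- Some mark of `P` reaches `v`. -/
def ReachSet (ends : E → Sym2 V) (P : Set V) (v : V) : Set (Config E) :=
  {ω | ∃ x ∈ P, Conn ends ω x v}

/-- `AllConn` is increasing. -/
lemma isUpperSet_allConn (ends : E → Sym2 V) (P : Set V) : IsUpperSet (AllConn ends P) :=
  fun _ _ hle h x hx y hy => conn_mono hle (h x hx y hy)

/-- `ReachSet` is increasing. -/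
lemma isUpperSet_reachSet (ends : E → Sym2 V) (P : Set V) (v : V) :
    IsUpperSet (ReachSet ends P v) :=
  fun _ _ hle ⟨x, hx, h⟩ => ⟨x, hx, conn_mono hle h⟩

/-- `AllConn` of a left mark set reads only the left edges. -/
lemma sideLocal_allConn_left (h : CutVertex ends side L v Rt) {P : Set V}
    (hP : ∀ x ∈ P, x ∈ L ∨ x = v) : SideLocal side true (AllConn ends P) := by
  intro ω ω' hag
  simp only [AllConn, Set.mem_setOf_eq]
  constructor
  · intro hc x hx y hy
    exact (conn_left_congr h (hP x hx) (hP y hy) hag).1 (hc x hx y hy)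
  · intro hc x hx y hy
    exact (conn_left_congr h (hP x hx) (hP y hy) hag).2 (hc x hx y hy)

/-- `ReachSet` of a left mark set reads only the left edges. -/
lemma sideLocal_reachSet_left (h : CutVertex ends side L v Rt) {P : Set V}
    (hP : ∀ x ∈ P, x ∈ L ∨ x = v) : SideLocal side true (ReachSet ends P v) := by
  intro ω ω' hag
  simp only [ReachSet, Set.mem_setOf_eq]
  constructor
  · rintro ⟨x, hx, hc⟩
    exact ⟨x, hx, (conn_left_congr h (hP x hx) (Or.inr rfl) hag).1 hc⟩
  · rintro ⟨x, hx, hc⟩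
    exact ⟨x, hx, (conn_left_congr h (hP x hx) (Or.inr rfl) hag).2 hc⟩

/-- `AllConn` of a right mark set reads only the right edges. -/
lemma sideLocal_allConn_right (h : CutVertex ends side L v Rt) {T : Set V}
    (hT : ∀ x ∈ T, x ∈ Rt ∨ x = v) : SideLocal side false (AllConn ends T) := by
  intro ω ω' hag
  simp only [AllConn, Set.mem_setOf_eq]
  constructor
  · intro hc x hx y hy
    exact (conn_right_congr h (hT x hx) (hT y hy) hag).1 (hc x hx y hy)
  · intro hc x hx y hy
    exact (conn_right_congr h (hT x hx) (hT y hy) hag).2 (hc x hx y hy)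

/-- `ReachSet` of a right mark set reads only the right edges. -/
lemma sideLocal_reachSet_right (h : CutVertex ends side L v Rt) {T : Set V}
    (hT : ∀ x ∈ T, x ∈ Rt ∨ x = v) : SideLocal side false (ReachSet ends T v) := by
  intro ω ω' hag
  simp only [ReachSet, Set.mem_setOf_eq]
  constructor
  · rintro ⟨x, hx, hc⟩
    exact ⟨x, hx, (conn_right_congr h (hT x hx) (Or.inr rfl) hag).1 hc⟩
  · rintro ⟨x, hx, hc⟩
    exact ⟨x, hx, (conn_right_congr h (hT x hx) (Or.inr rfl) hag).2 hc⟩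

/-- The one-colour separation of `P` from `T` at a cut vertex: `¬(P reaches v ∧ T reaches v)`. -/
lemma sepSets_iff (h : CutVertex ends side L v Rt) {P T : Set V}
    (hP : ∀ x ∈ P, x ∈ L ∨ x = v) (hT : ∀ x ∈ T, x ∈ Rt ∨ x = v) (ω : Config E) :
    (∀ x ∈ P, ∀ y ∈ T, ¬ Conn ends ω x y) ↔
      ¬ (ω ∈ ReachSet ends P v ∧ ω ∈ ReachSet ends T v) := by
  simp only [ReachSet, Set.mem_setOf_eq]
  constructor
  · rintro hsep ⟨⟨x, hx, hxv⟩, ⟨y, hy, hyv⟩⟩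
    exact hsep x hx y hy ((conn_cross_iff h (hP x hx) (hT y hy) ω).2 ⟨hxv, hyv⟩)
  · intro hn x hx y hy hc
    obtain ⟨hxv, hyv⟩ := (conn_cross_iff h (hP x hx) (hT y hy) ω).1 hc
    exact hn ⟨⟨x, hx, hxv⟩, ⟨y, hy, hyv⟩⟩

variable [Fintype E] [DecidableEq E]

/-- **`(G1)` at a cut vertex**: for mark sets `P ⊆ L ∪ {v}`, `T ⊆ Rt ∪ {v}`,
`Σ_{P ≁ T in both colours} (1[P in one Y-block] − 1[P in one W-block]) ·
  (1[T in one Y-block] − 1[T in one W-block]) ≤ 0`. -/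
theorem g1Sum_nonpos_of_cutVertex (h : CutVertex ends side L v Rt) {P T : Set V}
    (hP : ∀ x ∈ P, x ∈ L ∨ x = v) (hT : ∀ x ∈ T, x ∈ Rt ∨ x = v) :
    ∑ ω : Config E,
      (if (∀ x ∈ P, ∀ y ∈ T, ¬ Conn ends ω x y) ∧
          (∀ x ∈ P, ∀ y ∈ T, ¬ Conn ends (OneColourSwitch.compl ω) x y) then
        sigmaOf (AllConn ends P) ω * sigmaOf (AllConn ends T) ω else 0) ≤ 0 := by
  have key := sepSum_nonpos side (sideLocal_allConn_left h hP) (sideLocal_reachSet_left h hP)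
    (sideLocal_allConn_right h hT) (sideLocal_reachSet_right h hT)
    (isUpperSet_allConn ends P) (isUpperSet_reachSet ends P v)
    (isUpperSet_allConn ends T) (isUpperSet_reachSet ends T v)
  unfold sepSum at key
  have hiff : ∀ ω : Config E,
      ((∀ x ∈ P, ∀ y ∈ T, ¬ Conn ends ω x y) ∧
        (∀ x ∈ P, ∀ y ∈ T, ¬ Conn ends (OneColourSwitch.compl ω) x y)) ↔
        sepOf (ReachSet ends P v) (ReachSet ends T v) ω := by
    intro ω
    unfold sepOf
    rw [sepSets_iff h hP hT ω, sepSets_iff h hP hT (OneColourSwitch.compl ω)]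
  refine le_trans (le_of_eq (Finset.sum_congr rfl fun ω _ => ?_)) key
  exact if_congr (hiff ω) rfl rfl

end G1

end CutVertexM9

end Summit.Ventures.PercRepro2
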